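import Literature.Topology.FourManifolds.HomotopySpheresBPOrderSignatureLeavesProofs
import Literature.Topology.FourManifolds.ClosedModelOrientation
import Literature.Topology.FourManifolds.ParallelizableOrientation
import HarnessLib

/-!
# Kervaire–Milnor's Lemma 7.4: the vendored form from the printed form

Topic `Literature/Topology/FourManifolds`; pure-proof companion of the named fact
`Literature.Topology.FourManifolds.HomotopySphere.exists_mem_signatureSet_sphere_ne_zero`
(`HomotopySpheresSignature.lean`), which vendors M. Kervaire, J. Milnor, *Groups of homotopy
spheres: I*, Ann. of Math. (2) 77 (1963), **Lemma 7.4** (p. 529):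

> "For each `k = 2m` there exists a parallelizable manifold `M₀` whose boundary `bM₀` is the
> ordinary `(4m - 1)`-sphere, such that the signature `σ(M₀)` is non-zero."

with the printed proof "According to Milnor and Kervaire [18, p. 457] there exists a closed
'almost parallelizable' `4m`-manifold whose signature is non-zero. Removing the interior of an
imbedded `4m`-disk from this manifold, we obtain the required parallelizable manifold `M₀`."

The tree's statement is the consequence for the sets of signatures
`HomotopySphere.signatureSet g m h (𝕊ⁿ, o)` of §7 (p. 529, Thm. 7.5): for `n + 1 = 4m`, `m ≥ 1`
and every generator convention `g`, some orientation `o` of `𝕊ⁿ` and some **non-zero** integer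
`σ` with `σ ∈ signatureSet g m h (𝕊ⁿ, o)`, i.e. `σ = σ(M₀, μ')` for an **s-parallelizable** `M₀`
with `bM₀ = 𝕊ⁿ`, a homological orientation `μ` of `𝕊ⁿ` **compatible with `o`**
(`SmoothOrientation.IsCompatible g o μ`, Bredon VI.7.15) and an orientation `μ'` of the closed
model `M₀ ∪ cone(bM₀)` with **`(𝕊ⁿ, μ) = bM₀` as oriented manifolds** (`NullCobordism.IsOrientedBy`).
This file PROVES that the statement *as printed* — a (connected) parallelizable compact `M₀`
with `bM₀ = 𝕊ⁿ` and `σ(M₀) ≠ 0`, the signature being that of the cup-product form of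
`M₀ ∪ cone(bM₀)` for any of its orientations (footnote pp. 528–529: "we can adjoin a cone over
the boundary, thus obtaining a closed homology manifold with the same signature") — implies the
vendored one, for every `m ≥ 1` and every generator convention; what it does NOT prove is the
printed statement itself ([18] = Milnor–Kervaire, *Bernoulli numbers, homotopy groups and a
theorem of Rohlin*, Proc. ICM 1958, p. 457: Bott periodicity, the finiteness of the stable stems,
the Pontryagin–Thom construction and Hirzebruch's signature theorem, none of which is in the
tree), which enters as the hypothesis `H`, stated inline (no named fact is introduced, D-0026).

* `NullCobordism.nonempty_chartedSpace_closedModel_sphere` — for a null-cobordism `c` of the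
  **standard** sphere `𝕊ᵏ⁺¹`, the closed model `c.W ∪ cone(𝕊ᵏ⁺¹) = c.W ∪ 𝔻ᵏ⁺²` is a topological
  manifold: the atlas `NullCobordism.chartedSpaceClosedModel` (`ClosedModelCharts.lean`, Kosinski
  X, proof of (3.3)) from a collar of `bW` (the tree's collar theorem
  `BoundaryData.nonempty_collar_of_compactSpace`, Hirsch 4.6.1) and the identity `𝕊ᵏ⁺¹ ≃ₜ 𝕊ᵏ⁺¹` —
  unconditionally, in every dimension (no Poincaré conjecture is needed for the standard sphere).
* `HomotopySphere.exists_mem_signatureSet_sphere_of_smoothOrientation` — **the orientation clauses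
  of `signatureSet` are free for the standard sphere**: if `c` is a null-cobordism of `𝕊ⁿ`
  (`n + 1 = 4m`) with `c.W` connected, smoothly oriented and s-parallelizable, then for EVERY
  orientation `μ''` of the closed model and every `g`, `σ(c.W, μ'') ∈ signatureSet g m h (𝕊ⁿ, o)`
  for some smooth orientation `o` of `𝕊ⁿ`. Proof: the smooth orientation of `W` gives
  `(μ, μ')` with `(𝕊ⁿ, μ) = bW` (`NullCobordism.exists_isOrientedBy_of_smoothOrientation`,
  `ClosedModelOrientation.lean`: Hatcher p. 253, `∂[W, ∂W] = [∂W]`); on the connected closed model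
  `μ'' = ±μ'` (Hatcher p. 234, `HomologicalOrientation.eq_or_eq_neg_of_connected_holds`), and in
  the second case `(𝕊ⁿ, -μ) = b(-W)` (Kervaire–Milnor §2, `IsOrientedBoundary.neg` with
  `[X]_{-ν} = -[X]_ν`, `fundamentalClass_neg_holds` / `ClosedModel.fundamentalClass_neg`); finally
  `±μ` is compatible with some smooth orientation `o` of the connected `𝕊ⁿ` (Bredon VI.7.15,
  `SmoothOrientation.exists_isCompatible`).
* `HomotopySphere.exists_mem_signatureSet_sphere_of_isParallelizable` — the same from
  `IsParallelizable` (parallelizable ⇒ orientable, Lee Prop. 15.17,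
  `IsParallelizable.isOrientable`; ⇒ s-parallelizable, `IsParallelizable.isStablyParallelizable`).
* `HomotopySphere.exists_mem_signatureSet_sphere_ne_zero_of_isParallelizable` — **Lemma 7.4 as
  printed implies Lemma 7.4 as vendored**; `…_of_smoothOrientation'` the variant with "oriented
  s-parallelizable" for "parallelizable" (Kervaire–Milnor's Lemma 3.4: the same class of `M₀`).
* `HomotopySphere.exists_mem_signatureSet_sphere_ne_zero_iff_sigmaGen_ne_zero` — the vendored fact
  is EXACTLY "`σₘ ≠ 0` for every `m ≥ 1` (and every `g`)", the form in which §7 uses it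
  (p. 529: "Let `σₘ > 0` denote the generator of this group"; Cor. 7.6).

Connectedness of `M₀` is assumed, as in the printed proof (`M₀ = M ∖ D̊` for a closed connected
`M`); dropping it would require `σ = 0` for the closed s-parallelizable components (the signature
theorem again).

## References

* M. A. Kervaire, J. W. Milnor, *Groups of homotopy spheres: I*, Ann. of Math. (2) 77 (1963),
  504–537: Lemma 7.4 and its proof (p. 529), footnote pp. 528–529, Thm. 7.5, §2 (`-M`).
  [KervaireMilnorAnnals1963]
* J. Milnor, M. Kervaire, *Bernoulli numbers, homotopy groups, and a theorem of Rohlin*, Proc.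
  ICM Edinburgh 1958, CUP 1960, 454–458 (the reference [18] of the printed proof).
* G. Bredon, *Topology and Geometry*, GTM 139 (1993), VI.7, Thm. 7.15. [Bredon1993]
* A. Hatcher, *Algebraic Topology*, CUP 2002, §3.3 pp. 233–236, 253. [Hatcher2002]
* A. Kosinski, *Differential Manifolds*, Academic Press 1993, Ch. X, proof of (3.3). [Kosinski1993]
* J. M. Lee, *Introduction to Smooth Manifolds*, 2nd ed. (2013), Prop. 15.17. [LeeSmoothManifolds2013]
-/

open scoped Manifold ContDiff Topology
open Set Function

noncomputable section

namespace Literature.Topology.FourManifolds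

open Literature.AlgebraicTopology.SingularHomology

/-! ### The closed model of a null-cobordism of the standard sphere is a manifold -/

namespace NullCobordism

/-- **`W ∪ cone(𝕊ᵏ⁺¹) = W ∪ 𝔻ᵏ⁺²` is a topological manifold.** For a null-cobordism `c` of the
standard sphere `𝕊ᵏ⁺¹`, the closed model `ClosedModel (k + 1) c.W` carries an atlas modelled on
`ℝᵏ⁺²`: Kosinski's cone chart at `∞` along a collar of `bW = 𝕊ᵏ⁺¹` (*Differential Manifolds*
(1993), Ch. X, proof of (3.3); the tree's `NullCobordism.chartedSpaceClosedModel` fed the collar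
theorem `BoundaryData.nonempty_collar_of_compactSpace` and the identity homeomorphism of `𝕊ᵏ⁺¹`).
Kervaire–Milnor 1963, footnote pp. 528–529. [cite: Kosinski1993, Ch. X, proof of (3.3)] [cite: KervaireMilnorAnnals1963, §7, footnote pp. 528–529] -/
theorem nonempty_chartedSpace_closedModel_sphere {k : ℕ}
    (c : NullCobordism (k + 1) (Metric.sphere (0 : EuclideanSpace ℝ (Fin (k + 1 + 1))) 1)) :
    Nonempty (ChartedSpace (EuclideanSpace ℝ (Fin (k + 1 + 1))) (ClosedModel (k + 1) c.W)) := by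
  obtain ⟨κ⟩ := BoundaryData.nonempty_collar_of_compactSpace k c.W c.boundaryData
  haveI : Nonempty (Metric.sphere (0 : EuclideanSpace ℝ (Fin (k + 1 + 1))) 1) :=
    ⟨⟨EuclideanSpace.single 0 1, by simp⟩⟩
  exact ⟨c.chartedSpaceClosedModel κ (Homeomorph.refl _)⟩

end NullCobordism

namespace HomotopySphere

variable {n : ℕ}

/-! ### The orientation clauses of `signatureSet (𝕊ⁿ, o)` are free -/

/-- **`σ(M₀) ∈ signatureSet g m h (𝕊ⁿ, o)` for some `o`, for an oriented s-parallelizable `M₀`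
bounded by the standard sphere and ANY orientation of its closed model.** Let `n + 1 = 4m`, `c` a
null-cobordism of `𝕊ⁿ` with `M₀ = c.W` connected, smoothly oriented (`oW`) and s-parallelizable,
and `μ''` a homological orientation of `M₀ ∪ cone(bM₀)`. Then for every generator convention `g`
there is a smooth orientation `o` of `𝕊ⁿ` with `σ(M₀, μ'') ∈ signatureSet g m h (𝕊ⁿ, o)`
(Kervaire–Milnor 1963, §7, p. 529: "the collection of all `4m`-manifolds `M₀` which are
s-parallelizable and are bounded by the `(4m-1)`-sphere … the corresponding signatures
`σ(M₀)`"). The smooth orientation of `W` orients the boundary, `(𝕊ⁿ, μ) = bW` with the closed-model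
orientation `μ'` (Hatcher 2002, p. 253; `NullCobordism.exists_isOrientedBy_of_smoothOrientation`),
`μ'' = ±μ'` on the connected closed model (Hatcher p. 234), `(𝕊ⁿ, -μ) = b(-W)` (Kervaire–Milnor
§2, "`-M`"), and `±μ` is compatible with some smooth orientation of `𝕊ⁿ` (Bredon VI.7.15).
[cite: KervaireMilnorAnnals1963, §7, p. 529 (the manifolds M₀ bounded by the (4m−1)-sphere) and §2 (-M)] [cite: Hatcher2002, §3.3 pp. 234, 253] [cite: Bredon1993, VI.7, Thm. 7.15] -/
theorem exists_mem_signatureSet_sphere_of_smoothOrientation {m : ℕ} (h : n + 1 = 4 * m)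
    (g : HomologicalOrientation ℤ (EuclideanSpace ℝ (Fin n)) n)
    (c : NullCobordism n (Metric.sphere (0 : EuclideanSpace ℝ (Fin (n + 1))) 1)) [ConnectedSpace c.W]
    (oW : SmoothOrientation (𝓡∂ (n + 1)) c.W) (hspar : IsStablyParallelizable (𝓡∂ (n + 1)) c.W)
    (μ'' : HomologicalOrientation ℤ (ClosedModel n c.W) (n + 1)) :
    ∃ o : SmoothOrientation (𝓡 n) (Metric.sphere (0 : EuclideanSpace ℝ (Fin (n + 1))) 1),
      μ''.signatureInDim (show 2 * m + 2 * m = n + 1 by omega) ∈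
        signatureSet g m h ⟨Metric.sphere (0 : EuclideanSpace ℝ (Fin (n + 1))) 1, o, ⟨.refl _⟩⟩ := by
  obtain ⟨k, rfl⟩ : ∃ k, n = k + 1 := ⟨n - 1, by omega⟩
  -- the closed model `W ∪ 𝔻` is a connected topological manifold
  obtain ⟨_inst⟩ := c.nonempty_chartedSpace_closedModel_sphere
  haveI : Nonempty (Metric.sphere (0 : EuclideanSpace ℝ (Fin (k + 1 + 1))) 1) :=
    ⟨⟨EuclideanSpace.single 0 1, by simp⟩⟩
  haveI : ConnectedSpace (Metric.sphere (0 : EuclideanSpace ℝ (Fin (k + 1 + 1))) 1) :=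
    HomotopySphere.connectedSpace_sphere (Nat.succ_ne_zero k)
  haveI : ConnectedSpace (ClosedModel (k + 1) c.W) :=
    connectedSpace_closedModel (n := k + 1) (W := c.W)
      ⟨c.incl (Classical.arbitrary _), c.incl_mem_boundary _⟩
  -- `(𝕊ⁿ, μ) = bW` for the orientation of `W`
  obtain ⟨μ, μ', hob⟩ := c.exists_isOrientedBy_of_smoothOrientation oW
  -- the given orientation of the closed model is `±μ'`
  rcases HomologicalOrientation.eq_or_eq_neg_of_connected_holds (ClosedModel (k + 1) c.W) μ'' μ'
    with hμ | hμ
  · obtain ⟨o, ho⟩ := SmoothOrientation.exists_isCompatible g μ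
    exact ⟨o, μ, c, μ', ho, hspar, hob, by rw [hμ]⟩
  · obtain ⟨o, ho⟩ := SmoothOrientation.exists_isCompatible g (-μ)
    refine ⟨o, -μ, c, -μ', ho, hspar, ?_, by rw [hμ]⟩
    exact ((c.isOrientedBy_iff μ μ').1 hob).neg
      (HomologicalOrientation.fundamentalClass_neg_holds ℤ
        (Metric.sphere (0 : EuclideanSpace ℝ (Fin (k + 1 + 1))) 1) (k + 1) μ)
      (ClosedModel.fundamentalClass_neg μ')

/-- **`σ(M₀) ∈ signatureSet g m h (𝕊ⁿ, o)` for some `o`, for a parallelizable `M₀` bounded by the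
standard sphere** — the manifolds of Lemma 7.4 as printed ("a parallelizable manifold `M₀` whose
boundary `bM₀` is the ordinary `(4m-1)`-sphere", Kervaire–Milnor 1963, p. 529), connected, with any
orientation `μ''` of the closed model: parallelizable manifolds are orientable (Lee 2013,
Prop. 15.17, `IsParallelizable.isOrientable`) and s-parallelizable
(`IsParallelizable.isStablyParallelizable`), and `exists_mem_signatureSet_sphere_of_smoothOrientation`
applies. [cite: KervaireMilnorAnnals1963, Lemma 7.4 (p. 529)] [cite: LeeSmoothManifolds2013, Prop. 15.17] -/
theorem exists_mem_signatureSet_sphere_of_isParallelizable {m : ℕ} (h : n + 1 = 4 * m)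
    (g : HomologicalOrientation ℤ (EuclideanSpace ℝ (Fin n)) n)
    (c : NullCobordism n (Metric.sphere (0 : EuclideanSpace ℝ (Fin (n + 1))) 1)) [ConnectedSpace c.W]
    (hpar : IsParallelizable (𝓡∂ (n + 1)) c.W)
    (μ'' : HomologicalOrientation ℤ (ClosedModel n c.W) (n + 1)) :
    ∃ o : SmoothOrientation (𝓡 n) (Metric.sphere (0 : EuclideanSpace ℝ (Fin (n + 1))) 1),
      μ''.signatureInDim (show 2 * m + 2 * m = n + 1 by omega) ∈
        signatureSet g m h ⟨Metric.sphere (0 : EuclideanSpace ℝ (Fin (n + 1))) 1, o, ⟨.refl _⟩⟩ := by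
  obtain ⟨oW⟩ := hpar.isOrientable
  exact exists_mem_signatureSet_sphere_of_smoothOrientation h g c oW hpar.isStablyParallelizable μ''

/-! ### Lemma 7.4: printed ⇒ vendored -/

/-- **Kervaire–Milnor's Lemma 7.4 as printed implies Lemma 7.4 as vendored.** Hypothesis `H`
(Lemma 7.4, *Groups of homotopy spheres I* (1963), p. 529, verbatim up to the tree's vocabulary):
for each `m ≥ 1` (`n + 1 = 4m`) there is a null-cobordism `c` of the ordinary sphere `𝕊ⁿ` whose
bounding manifold `M₀ = c.W` is connected and parallelizable, with `σ(M₀) ≠ 0` — the signature of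
the cup-product form of the closed model `M₀ ∪ cone(bM₀)` (footnote pp. 528–529) for some (hence
every) orientation `μ'`. Conclusion: the named fact
`HomotopySphere.exists_mem_signatureSet_sphere_ne_zero` — for every `g`, some `σ ≠ 0` lies in
`signatureSet g m h (𝕊ⁿ, o)` for some `o`; by `exists_mem_signatureSet_sphere_of_isParallelizable`
with `σ = σ(M₀, μ')`. The hypothesis is what the printed proof obtains from Milnor–Kervaire [18,
p. 457] (a closed almost parallelizable `4m`-manifold with `σ ≠ 0`, minus the interior of a disc);
it is not proved in the tree. [cite: KervaireMilnorAnnals1963, Lemma 7.4 and its proof (p. 529), footnote pp. 528–529] -/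
theorem exists_mem_signatureSet_sphere_ne_zero_of_isParallelizable
    (H : ∀ (n m : ℕ) (h : n + 1 = 4 * m), 1 ≤ m →
      ∃ c : NullCobordism n (Metric.sphere (0 : EuclideanSpace ℝ (Fin (n + 1))) 1),
        ConnectedSpace c.W ∧ IsParallelizable (𝓡∂ (n + 1)) c.W ∧
          ∃ μ' : HomologicalOrientation ℤ (ClosedModel n c.W) (n + 1),
            μ'.signatureInDim (show 2 * m + 2 * m = n + 1 by omega) ≠ 0) :
    exists_mem_signatureSet_sphere_ne_zero := by
  intro n m h hm g
  obtain ⟨c, hconn, hpar, μ', hσ⟩ := H n m h hm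
  obtain ⟨o, ho⟩ := exists_mem_signatureSet_sphere_of_isParallelizable h g c hpar μ'
  exact ⟨o, _, ho, hσ⟩

/-- **Lemma 7.4 as vendored from oriented s-parallelizable manifolds bounded by the standard
sphere with non-zero signature** (the variant of
`exists_mem_signatureSet_sphere_ne_zero_of_isParallelizable` with "smoothly oriented and
s-parallelizable" for "parallelizable": by Kervaire–Milnor's Lemma 3.4, p. 509, "a connected
manifold with non-vacuous boundary is s-parallelizable if and only if it is parallelizable", the
same manifolds `M₀`; §7, p. 529: "all `4m`-manifolds `M₀` which are s-parallelizable and are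
bounded by the `(4m-1)`-sphere"). [cite: KervaireMilnorAnnals1963, §7, p. 529, with Lemma 3.4 (p. 509) and Lemma 7.4] -/
theorem exists_mem_signatureSet_sphere_ne_zero_of_smoothOrientation
    (H : ∀ (n m : ℕ) (h : n + 1 = 4 * m), 1 ≤ m →
      ∃ (c : NullCobordism n (Metric.sphere (0 : EuclideanSpace ℝ (Fin (n + 1))) 1))
        (_ : SmoothOrientation (𝓡∂ (n + 1)) c.W),
        ConnectedSpace c.W ∧ IsStablyParallelizable (𝓡∂ (n + 1)) c.W ∧
          ∃ μ' : HomologicalOrientation ℤ (ClosedModel n c.W) (n + 1),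
            μ'.signatureInDim (show 2 * m + 2 * m = n + 1 by omega) ≠ 0) :
    exists_mem_signatureSet_sphere_ne_zero := by
  intro n m h hm g
  obtain ⟨c, oW, hconn, hspar, μ', hσ⟩ := H n m h hm
  obtain ⟨o, ho⟩ := exists_mem_signatureSet_sphere_of_smoothOrientation h g c oW hspar μ'
  exact ⟨o, _, ho, hσ⟩

/-! ### The vendored fact is `σₘ ≠ 0` for every `m ≥ 1` -/

/-- **Lemma 7.4 as vendored says exactly that Kervaire–Milnor's `σₘ` is non-zero for every
`m ≥ 1`** (and every generator convention): "Thus there exists an s-parallelizable manifold `M₀`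
… with `σ(M₀) ≠ 0` … Clearly the corresponding signatures `σ(M₀) ∈ ℤ` form a group under
addition. Let `σₘ > 0` denote the generator of this group" (1963, p. 529). "⇒" is
`sigmaGen_ne_zero`; "⇐": if every signature of every oriented s-parallelizable manifold bounded
by `(𝕊ⁿ, o)`, `o` arbitrary, vanished, the subgroup they generate would be trivial and
`σₘ = sInf ∅ = 0` (the tree's junk value). [cite: KervaireMilnorAnnals1963, §7, p. 529 (Lemma 7.4 and the definition of σₘ)] -/
theorem exists_mem_signatureSet_sphere_ne_zero_iff_sigmaGen_ne_zero :
    exists_mem_signatureSet_sphere_ne_zero ↔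
      ∀ (n m : ℕ) (h : n + 1 = 4 * m), 1 ≤ m →
        ∀ g : HomologicalOrientation ℤ (EuclideanSpace ℝ (Fin n)) n, sigmaGen g m h ≠ 0 := by
  constructor
  · intro H n m h hm g
    obtain ⟨o, σ, hσ, hσ0⟩ := H n m h hm g
    exact sigmaGen_ne_zero (mem_sphereSignatureSubgroup hσ) hσ0
  · intro H n m h hm g
    by_contra hcon
    push Not at hcon
    refine H n m h hm g ?_
    have hbot : sphereSignatureSubgroup g m h = ⊥ := by
      rw [sphereSignatureSubgroup, AddSubgroup.closure_eq_bot_iff]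
      intro σ hσ
      obtain ⟨o, ho⟩ := mem_iUnion.1 hσ
      exact hcon o σ ho
    have hempty : {k : ℕ | 0 < k ∧ (k : ℤ) ∈ sphereSignatureSubgroup g m h} = ∅ := by
      ext k
      simp only [hbot, AddSubgroup.mem_bot, Nat.cast_eq_zero, mem_setOf_eq, mem_empty_iff_false,
        iff_false, not_and]
      omega
    rw [sigmaGen, hempty, Nat.sInf_empty]

end HomotopySphere

end Literature.Topology.FourManifolds
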